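import Literature.AlgebraicGeometry.HodgeTheory.CMProductsHodgeConjectureOfCodimTwo
import Literature.AlgebraicGeometry.Milne1999.SpecialLefschetzGroupInvariantsCMType
import Literature.AlgebraicGeometry.ComplexMultiplication.InducedCMTypeDominationOfRiemann
import Literature.AlgebraicGeometry.HodgeTheory.AbelianVarietyHodgeFullnessHolds
import Literature.AlgebraicGeometry.HodgeTheory.HodgeConjectureAbelianSubquotients
import Literature.AlgebraicGeometry.HodgeTheory.HodgeConjectureIsogenyInvariance
import Literature.AlgebraicGeometry.HodgeTheory.LefschetzOneOneHolds
import Literature.NumberTheory.NumberFields.CMFieldCompositum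
import HarnessLib

/-!
# The Hodge conjecture for CM abelian varieties follows from its codimension-two case (Hazama 2002/2003; Milne 2007 AIM talk, Thm. 8.5) — PROVED

Family `hodge`, layer `Literature/AlgebraicGeometry/HodgeTheory`. Theorems only; no definition, no named fact,
no `sorry`. This file turns the tree's conditional edge `cmHodgeHypothesisAt_of_codimTwo (h83 : Hazama2003_…) …`
of `GeneralHodgeCMTypeOfCodimTwo` into an UNCONDITIONAL theorem for the usual Hodge conjecture (the binder `h83`,
the general-Hodge-valued named fact, is not needed for the `HC`-valued conclusion and is not used).

## The printed statement

J. S. Milne, *The Tate conjecture over finite fields (AIM talk)*, arXiv:0709.3040 [Milne2007TateFiniteFieldsAIM]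
§8.2, VERBATIM: "**Theorem 8.5.** In order to prove the Hodge conjecture for CM abelian varieties over `ℂ`, it
suffices to prove it in codimension `2`." (= F. Hazama, Proc. Japan Acad. 78A (2002) [Hazama2002GHCCM] Thm. 7.6;
Publ. RIMS 39 (2003) [Hazama2003GHCCM] Thm. 8.3 p. 655, whose conclusion is even the GENERAL Hodge conjecture.)

## What is proved

* **`cmHodgeHypothesisAt_of_codimTwo_holds`** — `(∀ B, CMHodgeCodimTwoHypothesisAt B) → ∀ A, Milne1999.CMHodgeHypothesisAt A`:
  if every complex abelian variety of CM-type satisfies the Hodge conjecture in codimension two, every complex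
  abelian variety of CM-type satisfies the Hodge conjecture (Milne's hypothesis (H) of Thm. 7.1).
* `cmHodgeHypothesis_iff_codimTwo_holds` — `HC_CM ↔` its codimension-two case (unconditionally).
* `Milne1999.tateAV_Fq_of_hodge_codimTwo_cmType_holds` — with Milne 1999 Thm. 7.1 (`Theorem71 E`, the only
  remaining record): Tate's (0.1) for all abelian varieties over all finite fields from codimension-two Hodge
  classes on complex CM abelian varieties.

## Proof (the reduction to products over one Galois CM field)

Milne's proof: "If the Hodge conjecture holds in codimension `2`, then Theorem 8.3 shows that it holds for the
varieties `A(G,K,ρ_Φ)ⁿ`. However, every CM abelian variety `A` is isogenous to a quotient of such a variety, and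
so the Hodge conjecture holds for `A` also." In the tree's vocabulary: a CM abelian variety `X` of positive
dimension is isogenous to a product `⨁_i A_i` of realisations of CM types `(K_i; Φ_i)`
(`Milne1999.exists_isIsogeny_to_biproduct_of_classes_of_isOfCMType`); let `L ⊂ ℂ` be the Galois closure of the
compositum of the `K_i` (a Galois CM field, `isCMField_iSup_normalClosure`, `isGalois_iSup_normalClosure_complex`),
`k_i : K_i → L`, and `C_i` a realisation of the induced type `(L; Φ_i^L)` (`exists_isCMTypeRealisation`); by
Shimura §6.2 Thm. 3 in the tree's proved form `exists_retraction_of_inducedCMType_of_riemann` (fed the PROVED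
record `deligneMilne1982_Thm_6_20_full_holds`) `A_i` is a retract of `C_i` up to an isogeny `[N_i]`, hence
`⨁ A_i` is a retract of `⨁ C_i` up to `[∏ N_i]`; the Hodge conjecture for `⨁ C_i` is the product step
`CMCodimTwo.hodgeConjectureFor_biproduct_of_codimTwo`, and it descends along retractions
(`HodgeConjectureFor.of_comp_eq_nsmul_id`) and isogenies (`HodgeConjectureFor.of_isIsogenous`). Dimension `0`:
`hodgeConjectureFor_of_dim_le_three_holds`.

## References

* [Milne2007TateFiniteFieldsAIM] J. S. Milne, arXiv:0709.3040, §8.2 Thm. 8.3, Prop. 8.4, Thm. 8.5.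
* [Hazama2003GHCCM] F. Hazama, Publ. RIMS 39 (2003) 625–655, Thm. 8.2 p. 651, Thm. 8.3 p. 655.
* [Hazama2002GHCCM] F. Hazama, Proc. Japan Acad. 78A (2002) 72–75, Thm. 7.6.
* [Shimura1998] G. Shimura, *Abelian Varieties with Complex Multiplication and Modular Functions* (1998), §6.2
  Thm. 3, §6.1 Cor. of Thm. 2, §18.2 Lemma.
* [Milne1999] J. S. Milne, Lefschetz motives and the Tate conjecture, Compositio Math. 117 (1999), Thm. 7.1 p. 72.
* [DeligneMilne1982Tannakian] P. Deligne, J. S. Milne, Tannakian categories, LNM 900 (1982), Thm. 6.20.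
-/

noncomputable section

open scoped Classical
open CategoryTheory CategoryTheory.Limits NumberField

namespace Literature.AlgebraicGeometry.HodgeTheory

namespace CMCodimTwo

open Literature.AlgebraicTopology.SingularHomology
open Literature.AlgebraicGeometry.Motives (AbelianVariety CMType IsSmoothProjective)
open Literature.AlgebraicGeometry.ComplexMultiplication (IsCMTypeRealisation exists_isCMTypeRealisation
  exists_retraction_of_inducedCMType_of_riemann)
open Literature.NumberTheory.ComplexMultiplication (inducedCMType)
open Literature.NumberTheory.NumberFields (isCMField_iSup_normalClosure isGalois_iSup_normalClosure_complex)

/-! ### Retractions of biproducts -/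

/-- **A biproduct of retractions up to isogeny is a retraction up to isogeny**: from `s_i ≫ π_i = [N_i]`
(`N_i ≠ 0`) on each factor, `(⊕ s_i) ≫ (⊕ M_i π_i) = [∏ N_j]` on `⨁ A_i` with `M_i = ∏_{j ≠ i} N_j`.
[cite: MumfordAV1970, §19 Thm. 1 and Remark p. 169] -/
theorem exists_biproduct_comp_eq_nsmul_id {m : ℕ} {A C : Fin m → AbelianVariety ℂ} (s : ∀ i, A i ⟶ C i)
    (π : ∀ i, C i ⟶ A i) (N : Fin m → ℕ) (hN : ∀ i, N i ≠ 0) (h : ∀ i, s i ≫ π i = N i • 𝟙 (A i)) :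
    ∃ (t : ⨁ A ⟶ ⨁ C) (r : ⨁ C ⟶ ⨁ A) (M : ℕ), M ≠ 0 ∧ t ≫ r = M • 𝟙 (⨁ A) := by
  refine ⟨biproduct.map s, biproduct.map fun i => (∏ j ∈ Finset.univ.erase i, N j) • π i, ∏ j, N j,
    Finset.prod_ne_zero_iff.2 fun j _ => hN j, ?_⟩
  refine biproduct.hom_ext _ _ fun j => ?_
  rw [Category.assoc, biproduct.map_π, ← Category.assoc, biproduct.map_π, Category.assoc, Preadditive.comp_nsmul,
    h, smul_smul, Finset.prod_erase_mul _ _ (Finset.mem_univ j), Preadditive.comp_nsmul, Category.comp_id,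
    Preadditive.nsmul_comp, Category.id_comp]

/-! ### Every CM abelian variety is, up to isogeny, a retract of a product of realisations over one Galois CM field -/

/-- **Reduction to one Galois CM field** (Milne 2007 Prop. 8.2/8.4: "each [CM] abelian variety is isogenous to a
quotient of `A(G,K,ρ)ⁿ`"; Shimura §6.2 Thm. 3; Deligne 1982 §5 "`B_α = A_α ⊗_{E_α} E`"): a complex abelian
variety `X` of CM-type and positive dimension is isogenous to an abelian variety `Y` that is a retract, up to an
isogeny `[M]` (`M ≠ 0`), of a finite product `⨁ C_i` of realisations of CM types `Ψ_i` of ONE Galois CM field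
`L` — the Galois closure in `ℂ` of the compositum of the CM fields of the simple factors, the `Ψ_i` induced from
their types. [cite: Milne2007TateFiniteFieldsAIM, §8.1 Prop. 8.2 and proof of Thm. 8.5]
[cite: Shimura1998, §6.2 Thm. 3 and §18.2 Lemma] [cite: Milne1999LefschetzClasses, §1 Prop. 1.1 (p. 643)] -/
theorem exists_galoisCMField_realisations_retraction {X : AbelianVariety ℂ} (h0 : 0 < X.dim)
    (hCM : Milne1999.IsOfCMType X) :
    ∃ (L : Type) (_ : Field L) (_ : NumberField L) (_ : IsCMField L) (_ : IsGalois ℚ L) (N : ℕ)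
      (C : Fin N → AbelianVariety ℂ) (Ψ : Fin N → CMType L) (κ : ∀ i : Fin N, 𝓞 L →+* End (C i))
      (η : ∀ i : Fin N, L →+* Module.End ℂ (complexBetti (C i).X 1)),
      (∀ i, IsCMTypeRealisation (Ψ i) (C i) (κ i) (η i)) ∧
      ∃ (Y : AbelianVariety ℂ) (t : Y ⟶ ⨁ C) (r : ⨁ C ⟶ Y) (M : ℕ),
        M ≠ 0 ∧ t ≫ r = M • 𝟙 Y ∧ AbelianVariety.IsIsogenous X Y := by
  obtain ⟨Cl, _, K', _, _, _, Φ', A', ι', θ', m, cls, f, hA', -, -, hf⟩ :=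
    Milne1999.exists_isIsogeny_to_biproduct_of_classes_of_isOfCMType h0 hCM
  -- the common field: the Galois closure in `ℂ` of the compositum of the `K_i = K' (cls i)`
  let L₀ : IntermediateField ℚ ℂ := ⨆ i : Fin (m + 1), IntermediateField.normalClosure ℚ (K' (cls i)) ℂ
  haveI : FiniteDimensional ℚ L₀ := IntermediateField.finiteDimensional_iSup_of_finite
  haveI : NumberField L₀ := { to_charZero := inferInstance, to_finiteDimensional := inferInstance }
  have hCM₀ : IsCMField L₀ :=
    isCMField_iSup_normalClosure (F := fun i : Fin (m + 1) => K' (cls i)) (fun _ => Or.inr inferInstance)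
      (i₀ := 0) inferInstance
  haveI := hCM₀
  have hGal : IsGalois ℚ L₀ := isGalois_iSup_normalClosure_complex fun i : Fin (m + 1) => K' (cls i)
  -- embeddings `k_i : K_i → L₀`
  let σ : ∀ i : Fin (m + 1), K' (cls i) →+* ℂ := fun _ => Classical.arbitrary _
  have hmem : ∀ (i : Fin (m + 1)) (x : K' (cls i)), σ i x ∈ L₀ := fun i x =>
    ((AlgHom.fieldRange_le_normalClosure (σ i).toRatAlgHom).trans
      (le_iSup (fun i : Fin (m + 1) => IntermediateField.normalClosure ℚ (K' (cls i)) ℂ) i)) ⟨x, rfl⟩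
  let emb : ∀ i : Fin (m + 1), K' (cls i) →+* L₀ := fun i =>
    { toFun := fun x => ⟨σ i x, hmem i x⟩
      map_one' := Subtype.ext (map_one (σ i))
      map_mul' := fun x y => Subtype.ext (map_mul (σ i) x y)
      map_zero' := Subtype.ext (map_zero (σ i))
      map_add' := fun x y => Subtype.ext (map_add (σ i) x y) }
  -- realisations of the induced types over `L₀` and the retractions (Shimura §6.2 Thm. 3, proved form)
  have hCex : ∀ i : Fin (m + 1), ∃ (C : AbelianVariety ℂ) (κ : 𝓞 L₀ →+* End C)
      (η : L₀ →+* Module.End ℂ (complexBetti C.X 1)),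
      IsCMTypeRealisation (inducedCMType (emb i) (Φ' (cls i))) C κ η := fun i => exists_isCMTypeRealisation _
  choose C κ η hC using hCex
  have hret : ∀ i : Fin (m + 1), ∃ (s : A' (cls i) ⟶ C i) (π : C i ⟶ A' (cls i)) (N : ℕ),
      N ≠ 0 ∧ s ≫ π = N • 𝟙 (A' (cls i)) := fun i =>
    exists_retraction_of_inducedCMType_of_riemann deligneMilne1982_Thm_6_20_full_holds (emb i) (Φ' (cls i))
      (hA' (cls i)) (hC i)
  choose s π Nn hNn hsπ using hret
  obtain ⟨t, r, M, hM, htr⟩ := exists_biproduct_comp_eq_nsmul_id (A := fun i => A' (cls i)) s π Nn hNn hsπ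
  exact ⟨L₀, inferInstance, inferInstance, hCM₀, hGal, m + 1, C, fun i => inducedCMType (emb i) (Φ' (cls i)), κ, η,
    hC, ⨁ (fun i => A' (cls i)), t, r, M, hM, htr, ⟨f, hf⟩⟩

/-! ### Milne's Theorem 8.5 -/

/-- **Milne 2007 (AIM talk) Thm. 8.5 = Hazama 2002 Thm. 7.6 / 2003 Thm. 8.3 (usual-Hodge-conjecture form),
PROVED: the Hodge conjecture for complex abelian varieties of CM-type follows from its codimension-two case.**
If every complex abelian variety of CM-type satisfies the Hodge conjecture in codimension `2`
(`CMHodgeCodimTwoHypothesisAt`, everywhere), then every complex abelian variety of CM-type satisfies the Hodge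
conjecture (Milne 1999's hypothesis (H), `Milne1999.CMHodgeHypothesisAt`, everywhere). "If the Hodge conjecture
holds in codimension 2, then Theorem 8.3 shows that it holds for the varieties `A(G,K,ρ_Φ)ⁿ`. However, every CM
abelian variety `A` is isogenous to a quotient of such a variety, and so the Hodge conjecture holds for `A` also."
[cite: Milne2007TateFiniteFieldsAIM, §8.2 Thm. 8.5 with proof] [cite: Hazama2003GHCCM, Thm. 8.3 p. 655]
[cite: Hazama2002GHCCM, Thm. 7.6] -/
theorem cmHodgeHypothesisAt_of_codimTwo_holds (h2 : ∀ B : AbelianVariety ℂ, CMHodgeCodimTwoHypothesisAt B)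
    (X : AbelianVariety ℂ) : Milne1999.CMHodgeHypothesisAt X := by
  intro hX hCM
  by_cases h0 : X.dim = 0
  · exact hodgeConjectureFor_of_dim_le_three_holds (by omega) hX
  obtain ⟨L, _, _, _, _, N, C, Ψ, κ, η, hC, Y, t, r, M, hM, htr, hXY⟩ :=
    exists_galoisCMField_realisations_retraction (Nat.pos_of_ne_zero h0) hCM
  exact HodgeConjectureFor.of_isIsogenous hXY
    (HodgeConjectureFor.of_comp_eq_nsmul_id t r hM htr (hodgeConjectureFor_biproduct_of_codimTwo hC h2))

/-- `HC_CM` from its codimension-two case, universally quantified form. [cite: Milne2007TateFiniteFieldsAIM, §8.2 Thm. 8.5] -/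
theorem cmHodgeHypothesis_of_codimTwo_holds (h2 : ∀ B : AbelianVariety ℂ, CMHodgeCodimTwoHypothesisAt B) :
    ∀ A : AbelianVariety ℂ, Milne1999.CMHodgeHypothesisAt A :=
  cmHodgeHypothesisAt_of_codimTwo_holds h2

/-- **`HC_CM` is EQUIVALENT to its codimension-two case**, unconditionally (the tree's
`cmHodgeHypothesis_iff_codimTwo` without the record `h83`). [cite: Milne2007TateFiniteFieldsAIM, §8.2 Thm. 8.5]
[cite: Hazama2003GHCCM, Abstract p. 625 and Thm. 8.3 p. 655] -/
theorem cmHodgeHypothesis_iff_codimTwo_holds :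
    (∀ A : AbelianVariety ℂ, Milne1999.CMHodgeHypothesisAt A) ↔ ∀ B : AbelianVariety ℂ, CMHodgeCodimTwoHypothesisAt B :=
  ⟨fun h B => (h B).codimTwo, cmHodgeHypothesis_of_codimTwo_holds⟩

end CMCodimTwo

end Literature.AlgebraicGeometry.HodgeTheory

namespace Literature.AlgebraicGeometry.Milne1999

open Literature.AlgebraicGeometry.HodgeTheory
open Literature.AlgebraicGeometry.Motives

/-- **Tate's (0.1) for every abelian variety over every finite field, from codimension-two Hodge classes on complex
CM abelian varieties and Milne 1999 Thm. 7.1** — the tree's `tateAV_Fq_of_hodge_codimTwo_cmType` with Hazama's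
record DISCHARGED (`CMCodimTwo.cmHodgeHypothesisAt_of_codimTwo_holds`); the only remaining hypothesis beyond the
codimension-two Hodge classes is Milne's Theorem 7.1 at the intended ℓ-adic data (`Theorem71 E`).
[cite: Milne1999, Thm. 7.1 p. 72] [cite: Milne2007TateFiniteFieldsAIM, §8.2 Thm. 8.5 and Thm. 7.4] -/
theorem tateAV_Fq_of_hodge_codimTwo_cmType_holds
    {E : ∀ (k : Type) [Field k] [Finite k] (ℓ : ℕ) [Fact ℓ.Prime] [NeZero (ℓ : k)],
      GaloisWeilCohomology k ℚ_[ℓ] (padicCyclotomicCharacter k ℓ)}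
    (h71 : Theorem71 E) (h2 : ∀ B : AbelianVariety ℂ, CMHodgeCodimTwoHypothesisAt B) : TateStatement01 E :=
  tateAV_Fq_of_HC_CM h71 (CMCodimTwo.cmHodgeHypothesis_of_codimTwo_holds h2)

end Literature.AlgebraicGeometry.Milne1999

end
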